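import Summits.HodgeConjecture.CorCM.DihedralSexticPairHodgeOfMarkman
import Summits.HodgeConjecture.CorCM.NonGaloisSexticCMFrame
import Summits.HodgeConjecture.CorCM.CyclicSexticInducedType
import Summits.HodgeConjecture.CorCM.WeilFourfoldOfMarkmanPlane
import Literature.AlgebraicGeometry.Milne1999.CMHodgeHypothesisFromCMTypedProducts
import HarnessLib

/-!
# COR-CM — the Hodge conjecture, modulo Markman's fourfold theorem, for `B₀ × B₁`: two non-isogenous simple CM
# threefolds with CM by a NON-Galois sextic CM field `K ⊇ k` (intrinsic form)

Cell `pub-hodgecm2` (COR-CM), seat b30 gen 14 (2026-08-21); COUNT-NEUTRAL; theorems only, no definition, no named fact,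
no `sorry`.  The intrinsic form of `CorCM/DihedralSexticPairHodgeOfMarkman.lean`: the FRAME hypotheses of
`DihedralSexticPair.hodgeConjectureFor_biproduct_of_frame_of_markman` are DERIVED from

* `K` a CM field of degree `6` that is NOT Galois over `ℚ`, containing (via `i`) an imaginary quadratic field `k`
  (a CM field of degree `2`) — equivalently `K = k·F₀` with `F₀ = K⁺` a non-cyclic totally real cubic;
* two realisations `A_j ⊨ (K; Φ_j)` (`IsCMTypeRealisation`) whose types are NOT induced from `k` (`Φ_j` contains two
  embeddings with different restrictions along `i`: `hprim`, i.e. `Φ_j` primitive, `A_j` simple) and inequivalent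
  under `Aut(K) = {1, c}`: `Φ₁ ≠ Φ₀` and `Φ₁ ≠ Φ̄₀ = Φ₀ᶜ` (`A₀`, `A₁` not isogenous);

by `CorCM/NonGaloisStabilizer.lean` + `CorCM/NonGaloisSexticCMFrame.lean` (every permutation of the three extensions of
an embedding of `k` is realised by `Aut(ℂ)`; the frame `Hom(K, ℂ) ≃ ℤ/3 × Bool`), after normalising: choose `τ` (and the
sign of `δ`) so that ONE member of `Φ₀` extends `τ`; if two members of `Φ₁` extend `τ`, replace the realisation of `Φ₁`
by the conjugate realisation of `Φ̄₁` on the same `A₁` (`IsCMTypeRealisation.transport` along `c_K`); enumerate the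
`τ`-fibre as `(s₀, s₁, s₂)` with `Φ₀ ∋ s₀`, `Φ₁ ∋ s₁`.

MAIN: `hodgeConjectureFor_biproduct_of_not_isGalois_of_markman` — **`HodgeConjectureFor (⨁_{j<2} A_j)` GIVEN ONLY
`Markman2025_weilClasses_algebraic_abelianFourfold`**; `…_prod_…` and `…_of_avDominatedBy_…` (the isogeny factors of
`A₀ ⊕ A₁`; powers `A₀^a × A₁^b` carry further balanced weights and are NOT covered).  Conditional on Markman only.

## References
* [Markman2025SurveySecant] E. Markman, arXiv:2509.23403, Thm. 1.2 and §11.5 Step 2.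
* [Pohlmann1968] H. Pohlmann, Ann. of Math. 88 (1968), Thm 1.  [GaoUllmo2025] Z. Gao, E. Ullmo, J. Inst. Math. Jussieu
  25 (2025), Thm 3.1.  [MoonenZarhin1999LowDim] B. Moonen, Yu. Zarhin, Duke Math. J. 98 (1999), Thm. 0.1.
* [Shimura1998] G. Shimura, *Abelian Varieties with CM and Modular Functions* (1998), §5.2, §8.4, §18.2.
  [Lang2002] S. Lang, *Algebra*, 3rd ed., V §3, VI §1.
-/

noncomputable section

open CategoryTheory CategoryTheory.Limits NumberField

namespace Summit.HodgeConjecture.CorCM.DihedralSexticPair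

open Literature.AlgebraicGeometry Literature.AlgebraicGeometry.Motives Literature.AlgebraicGeometry.HodgeTheory
open Literature.AlgebraicGeometry.ComplexMultiplication (IsCMTypeRealisation)
open Literature.NumberTheory.Automorphic.PicardCM.CMCode (cmTypeMap mem_cmTypeMap_iff)
open Summit.HodgeConjecture.CorCM.NonGaloisField

open scoped Classical

/-! ## §1 Counting in the `τ`-fibre -/

section Counting

variable {K : Type} [Field K] [NumberField K] {k : Type} [Field k] {i : k →+* K} {τ : k →+* ℂ}
  (hττ : ComplexEmbedding.conjugate τ ≠ τ)
  (hdich : ∀ s : K →+* ℂ, s.comp i = τ ∨ s.comp i = ComplexEmbedding.conjugate τ)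

include hττ hdich in
/-- **The `τ`-fibre has three elements** when `[K:ℚ] = 6`: conjugation is a bijection onto the `τ̄`-fibre and the two
fibres partition `Hom(K, ℂ)`. [folklore] -/
theorem card_fibre_eq_three (h6 : Module.finrank ℚ K = 6) :
    (Finset.univ.filter fun s : K →+* ℂ => s.comp i = τ).card = 3 := by
  have hneg : ∀ s : K →+* ℂ, ¬ s.comp i = τ ↔ s.comp i = ComplexEmbedding.conjugate τ := fun s =>
    ⟨fun h => (hdich s).resolve_left h, fun h h' => hττ (h ▸ h'.symm ▸ rfl)⟩
  have himage : (Finset.univ.filter fun s : K →+* ℂ => ¬ s.comp i = τ) =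
      (Finset.univ.filter fun s : K →+* ℂ => s.comp i = τ).image ComplexEmbedding.conjugate := by
    ext s
    simp only [Finset.mem_filter, Finset.mem_univ, true_and, Finset.mem_image]
    rw [hneg]
    constructor
    · intro h
      refine ⟨ComplexEmbedding.conjugate s, ?_, ComplexEmbedding.involutive_conjugate K s⟩
      rw [conjugate_comp, h, ComplexEmbedding.involutive_conjugate k τ]
    · rintro ⟨s', hs', rfl⟩
      rw [conjugate_comp, hs']
  have hsum := Finset.card_filter_add_card_filter_not (s := (Finset.univ : Finset (K →+* ℂ)))
    (fun s : K →+* ℂ => s.comp i = τ)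
  rw [himage, Finset.card_image_of_injective _ (ComplexEmbedding.involutive_conjugate K).injective,
    Finset.card_univ, Embeddings.card, h6] at hsum
  omega

include hττ hdich in
/-- **For a CM type, the members extending `τ` and those extending `τ̄` number three together** (conjugation maps
the `τ`-fibre outside `Φ` onto the `τ̄`-fibre inside `Φ`). [cite: Shimura1998, §5.2] -/
theorem card_fibre_mem_add (h6 : Module.finrank ℚ K = 6) (Φ : CMType K) :
    (Finset.univ.filter fun s : K →+* ℂ => s.comp i = τ ∧ s ∈ Φ.1).card +
      (Finset.univ.filter fun s : K →+* ℂ => s.comp i = ComplexEmbedding.conjugate τ ∧ s ∈ Φ.1).card = 3 := by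
  have himage : (Finset.univ.filter fun s : K →+* ℂ => s.comp i = ComplexEmbedding.conjugate τ ∧ s ∈ Φ.1) =
      ((Finset.univ.filter fun s : K →+* ℂ => s.comp i = τ).filter fun s => s ∉ Φ.1).image
        ComplexEmbedding.conjugate := by
    ext s
    simp only [Finset.mem_filter, Finset.mem_univ, true_and, Finset.mem_image]
    constructor
    · rintro ⟨h1, h2⟩
      refine ⟨ComplexEmbedding.conjugate s, ⟨?_, ?_⟩, ComplexEmbedding.involutive_conjugate K s⟩
      · rw [conjugate_comp, h1, ComplexEmbedding.involutive_conjugate k τ]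
      · exact (Φ.2 s).1 h2
    · rintro ⟨s', ⟨h1, h2⟩, rfl⟩
      refine ⟨by rw [conjugate_comp, h1], ?_⟩
      by_contra h3
      exact h2 ((Φ.2 s').2 h3)
  have hsplit := Finset.card_filter_add_card_filter_not
    (s := Finset.univ.filter fun s : K →+* ℂ => s.comp i = τ) (fun s : K →+* ℂ => s ∈ Φ.1)
  rw [Finset.filter_filter, card_fibre_eq_three hττ hdich h6] at hsplit
  rw [himage, Finset.card_image_of_injective _ (ComplexEmbedding.involutive_conjugate K).injective]
  exact hsplit

include hdich in
/-- A type that is not induced along `i` (two members with different restrictions) meets the `τ`-fibre.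
[cite: Shimura1998, §8.4] -/
theorem card_fibre_mem_pos {Φ : CMType K} (hprim : ∃ s ∈ Φ.1, ∃ s' ∈ Φ.1, s.comp i ≠ s'.comp i) :
    0 < (Finset.univ.filter fun s : K →+* ℂ => s.comp i = τ ∧ s ∈ Φ.1).card := by
  obtain ⟨s, hs, s', hs', hne⟩ := hprim
  rw [Finset.card_pos]
  rcases hdich s with h | h
  · exact ⟨s, by simp [h, hs]⟩
  · rcases hdich s' with h' | h'
    · exact ⟨s', by simp [h', hs']⟩
    · exact absurd (h.trans h'.symm) hne

include hττ hdich in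
/-- **A non-induced type has one or two members over `τ`.** [cite: Shimura1998, §8.4] -/
theorem card_fibre_mem_eq_one_or_two (h6 : Module.finrank ℚ K = 6) {Φ : CMType K}
    (hprim : ∃ s ∈ Φ.1, ∃ s' ∈ Φ.1, s.comp i ≠ s'.comp i) :
    (Finset.univ.filter fun s : K →+* ℂ => s.comp i = τ ∧ s ∈ Φ.1).card = 1 ∨
      ((Finset.univ.filter fun s : K →+* ℂ => s.comp i = τ ∧ s ∈ Φ.1).card = 2 ∧
        (Finset.univ.filter fun s : K →+* ℂ => s.comp i = ComplexEmbedding.conjugate τ ∧ s ∈ Φ.1).card = 1) := by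
  have h3 := card_fibre_mem_add hττ hdich h6 Φ
  have h1 := card_fibre_mem_pos (τ := τ) hdich hprim
  have hdich' : ∀ s : K →+* ℂ, s.comp i = ComplexEmbedding.conjugate τ ∨
      s.comp i = ComplexEmbedding.conjugate (ComplexEmbedding.conjugate τ) := fun s => by
    rw [ComplexEmbedding.involutive_conjugate k τ]; exact (hdich s).symm
  have h2 := card_fibre_mem_pos (τ := ComplexEmbedding.conjugate τ) hdich' hprim
  omega

omit [NumberField K] in
include hdich in
/-- A CM type is determined by its members over `τ` (it contains exactly one of `s`, `s̄`). [cite: Shimura1998, §5.2] -/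
theorem cmType_ext_of_fibre {Φ₀ Φ₁ : CMType K}
    (h : ∀ s : K →+* ℂ, s.comp i = τ → (s ∈ Φ₀.1 ↔ s ∈ Φ₁.1)) : Φ₀.1 = Φ₁.1 := by
  ext s
  rcases hdich s with hs | hs
  · exact h s hs
  · have hc : (ComplexEmbedding.conjugate s).comp i = τ := by
      rw [conjugate_comp, hs, ComplexEmbedding.involutive_conjugate k τ]
    rw [Φ₀.2 s, Φ₁.2 s, h _ hc]

end Counting

/-! ## §2 The normalised case: one member of each type over `τ` -/

section Normalised

variable {K : Type} [Field K] [NumberField K] [IsCMField K] {k : Type} [Field k] [NumberField k] [IsCMField k]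
  {A : Fin 2 → AbelianVariety ℂ} {Φ : Fin 2 → CMType K} {ι : ∀ j, 𝓞 K →+* End (A j)}
  {θ : ∀ j, K →+* Module.End ℂ (complexBetti (A j).X 1)}

/-- **The normalised case.**  `K/ℚ` not Galois, `τ(δ) = i√d`, and exactly one member `s_j` of `Φ_j` extends `τ`
(`j = 0, 1`), `Φ₀ ≠ Φ₁`: then `HodgeConjectureFor (⨁_{j<2} A_j)` modulo Markman — enumerate the `τ`-fibre as
`(s₀, s₁, s₂)`, take the frame of `NonGaloisField.exists_frame`, read `Φ_j` in it, and apply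
`hodgeConjectureFor_biproduct_of_frame_of_markman`. [cite: Markman2025SurveySecant, Thm. 1.2] [cite: Lang2002, VI §1] -/
theorem hodgeConjectureFor_biproduct_of_card_fibre_eq_one_of_markman
    (hW4 : Markman2025_weilClasses_algebraic_abelianFourfold)
    (h6 : Module.finrank ℚ K = 6) (h2 : Module.finrank ℚ k = 2) (i : k →+* K) (hK : ¬ IsGalois ℚ K)
    {δ : 𝓞 k} {d : ℕ} (hd : 0 < d) (hδ : ((δ : k)) ^ 2 = -(d : k))
    {τ : k →+* ℂ} (hτ : τ (δ : k) = Complex.I * (Real.sqrt d : ℂ))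
    (hA : ∀ j, IsCMTypeRealisation (Φ j) (A j) (ι j) (θ j))
    (hone : ∀ j : Fin 2, (Finset.univ.filter fun s : K →+* ℂ => s.comp i = τ ∧ s ∈ (Φ j).1).card = 1)
    (hne : (Φ 0).1 ≠ (Φ 1).1) :
    HodgeConjectureFor (⨁ A).dim (⨁ A).X := by
  have hττ : ComplexEmbedding.conjugate τ ≠ τ := CMThreefoldPair.conjugate_ne_of_apply_eq hd hτ
  have hdich : ∀ s : K →+* ℂ, s.comp i = τ ∨ s.comp i = ComplexEmbedding.conjugate τ := fun s =>
    eq_or_eq_conjugate h2 hd hτ (s.comp i)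
  -- the distinguished members `s₀ ∈ Φ₀`, `s₁ ∈ Φ₁` over `τ`
  have hsj : ∀ j : Fin 2, ∃ sj : K →+* ℂ, (sj.comp i = τ ∧ sj ∈ (Φ j).1) ∧
      ∀ s : K →+* ℂ, s.comp i = τ → s ∈ (Φ j).1 → s = sj := fun j => by
    obtain ⟨sj, hsj⟩ := Finset.card_eq_one.1 (hone j)
    have hmem : ∀ s, s ∈ (Finset.univ.filter fun s : K →+* ℂ => s.comp i = τ ∧ s ∈ (Φ j).1) ↔ s = sj := by
      intro s; rw [hsj, Finset.mem_singleton]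
    refine ⟨sj, by simpa using (hmem sj).2 rfl, fun s h1 h2 => (hmem s).1 (by simp [h1, h2])⟩
  choose sj hsj husj using hsj
  have h01 : sj 0 ≠ sj 1 := by
    intro heq
    apply hne
    refine cmType_ext_of_fibre hdich fun s hs => ⟨fun h => ?_, fun h => ?_⟩
    · rw [husj 0 s hs h, heq]; exact (hsj 1).2
    · rw [husj 1 s hs h, ← heq]; exact (hsj 0).2
  -- a third member of the fibre
  obtain ⟨s₂, hs₂, hs₂0, hs₂1⟩ : ∃ s₂ : K →+* ℂ, s₂.comp i = τ ∧ s₂ ≠ sj 0 ∧ s₂ ≠ sj 1 := by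
    by_contra hno
    push Not at hno
    have hsub : (Finset.univ.filter fun s : K →+* ℂ => s.comp i = τ) ⊆ {sj 0, sj 1} := by
      intro s hs
      rw [Finset.mem_filter] at hs
      rw [Finset.mem_insert, Finset.mem_singleton]
      by_cases h0 : s = sj 0
      · exact Or.inl h0
      · exact Or.inr (hno s hs.2 h0)
    have hle := Finset.card_le_card hsub
    rw [card_fibre_eq_three hττ hdich h6, Finset.card_pair h01] at hle
    omega
  -- the enumeration `t = (s₀, s₁, s₂)` of the `τ`-fibre
  set t : ZMod 3 → (K →+* ℂ) := ![sj 0, sj 1, s₂] with ht_def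
  have ht0 : t 0 = sj 0 := rfl
  have ht1 : t 1 = sj 1 := rfl
  have ht2 : t 2 = s₂ := rfl
  have hti : ∀ p, (t p).comp i = τ := by
    intro p; fin_cases p
    · exact (hsj 0).1
    · exact (hsj 1).1
    · exact hs₂
  have ht : Function.Injective t := by
    intro p q hpq
    fin_cases p <;> fin_cases q
    · rfl
    · exact absurd hpq h01
    · exact absurd hpq fun h => hs₂0 h.symm
    · exact absurd hpq (Ne.symm h01)
    · rfl
    · exact absurd hpq fun h => hs₂1 h.symm
    · exact absurd hpq hs₂0
    · exact absurd hpq hs₂1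
    · rfl
  obtain ⟨e, het, hec, hcases, he_conj, he_sign, he_gal⟩ := exists_frame hττ hdich ht hti hK h6
  -- the types read in the frame
  have hmemt : ∀ (j : Fin 2) (p : ZMod 3), t p ∈ (Φ j).1 ↔ p.val = j.val := by
    intro j p
    fin_cases j
    · constructor
      · intro h
        have := ht ((husj 0 (t p) (hti p) h).trans ht0.symm)
        rw [this]; rfl
      · intro h
        have hp : p = 0 := Fin.ext h
        rw [hp, ht0]; exact (hsj 0).2
    · constructor
      · intro h
        have := ht ((husj 1 (t p) (hti p) h).trans ht1.symm)
        rw [this]; rfl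
      · intro h
        have hp : p = 1 := Fin.ext h
        rw [hp, ht1]; exact (hsj 1).2
  have hΦ : ∀ (j : Fin 2) (s : K →+* ℂ), s ∈ (Φ j).1 ↔ (e s).2 = decide ((e s).1.val = j.val) := by
    intro j s
    obtain ⟨p, rfl | rfl⟩ := hcases s
    · rw [het, hmemt]
      simp
    · rw [hec, (Φ j).2, ComplexEmbedding.involutive_conjugate K, hmemt]
      simp
  exact hodgeConjectureFor_biproduct_of_frame_of_markman hW4 h6 h2 i hd hδ hτ hA e he_conj he_sign he_gal hΦ

end Normalised

/-! ## §3 The general case: normalising `τ` and the realisation of `Φ₁` -/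

section General

variable {K : Type} [Field K] [NumberField K] [IsCMField K] {k : Type} [Field k] [NumberField k] [IsCMField k]
  {A : Fin 2 → AbelianVariety ℂ} {Φ : Fin 2 → CMType K} {ι : ∀ j, 𝓞 K →+* End (A j)}
  {θ : ∀ j, K →+* Module.End ℂ (complexBetti (A j).X 1)}

/-- Members of the conjugate type `Φ̄ = Φ ∘ c_K` (`cmTypeMap` along complex conjugation of `K`) are the non-members of
`Φ`. [cite: Shimura1998, §5.2] -/
theorem mem_cmTypeMap_complexConj_iff (Ψ : CMType K) (s : K →+* ℂ) :
    s ∈ (cmTypeMap (IsCMField.complexConj K).toRingEquiv Ψ).1 ↔ s ∉ Ψ.1 := by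
  rw [mem_cmTypeMap_iff]
  have hc : s.comp (IsCMField.complexConj K).toRingEquiv.toRingHom = ComplexEmbedding.conjugate s :=
    RingHom.ext fun a => IsCMField.complexEmbedding_complexConj K s a
  rw [hc, ← not_iff_not, ← Ψ.2 s, not_not]

/-- **With `τ` normalised for `Φ₀` (one member over `τ`), the Hodge conjecture for `⨁_{j<2} A_j` modulo Markman**:
if `Φ₁` has two members over `τ`, pass to the conjugate realisation of `Φ̄₁` on `A₁` (`IsCMTypeRealisation.transport`
along `c_K`), which has one. [cite: Markman2025SurveySecant, Thm. 1.2] [cite: Shimura1998, §5.2] -/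
theorem hodgeConjectureFor_biproduct_of_card_fibre_zero_eq_one_of_markman
    (hW4 : Markman2025_weilClasses_algebraic_abelianFourfold)
    (h6 : Module.finrank ℚ K = 6) (h2 : Module.finrank ℚ k = 2) (i : k →+* K) (hK : ¬ IsGalois ℚ K)
    {δ : 𝓞 k} {d : ℕ} (hd : 0 < d) (hδ : ((δ : k)) ^ 2 = -(d : k))
    {τ : k →+* ℂ} (hτ : τ (δ : k) = Complex.I * (Real.sqrt d : ℂ))
    (hA : ∀ j, IsCMTypeRealisation (Φ j) (A j) (ι j) (θ j))
    (hone : (Finset.univ.filter fun s : K →+* ℂ => s.comp i = τ ∧ s ∈ (Φ 0).1).card = 1)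
    (hprim : ∃ s ∈ (Φ 1).1, ∃ s' ∈ (Φ 1).1, s.comp i ≠ s'.comp i)
    (hne : (Φ 0).1 ≠ (Φ 1).1) (hne' : (Φ 1).1 ≠ (Φ 0).1ᶜ) :
    HodgeConjectureFor (⨁ A).dim (⨁ A).X := by
  have hττ : ComplexEmbedding.conjugate τ ≠ τ := CMThreefoldPair.conjugate_ne_of_apply_eq hd hτ
  have hdich : ∀ s : K →+* ℂ, s.comp i = τ ∨ s.comp i = ComplexEmbedding.conjugate τ := fun s =>
    eq_or_eq_conjugate h2 hd hτ (s.comp i)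
  rcases card_fibre_mem_eq_one_or_two hττ hdich h6 hprim with h1 | ⟨h12, h1c⟩
  · exact hodgeConjectureFor_biproduct_of_card_fibre_eq_one_of_markman hW4 h6 h2 i hK hd hδ hτ hA
      (Fin.forall_fin_two.2 ⟨hone, h1⟩) hne
  · -- conjugate the realisation of slot `1`
    set c : K ≃+* K := (IsCMField.complexConj K).toRingEquiv with hc
    set Φ' : Fin 2 → CMType K := fun j => if j = 1 then cmTypeMap c (Φ j) else Φ j with hΦ'
    set ι' : ∀ j, 𝓞 K →+* End (A j) := fun j =>
      if j = 1 then (ι j).comp (RingOfIntegers.mapRingEquiv c.symm).toRingHom else ι j with hι'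
    set θ' : ∀ j, K →+* Module.End ℂ (complexBetti (A j).X 1) := fun j =>
      if j = 1 then (θ j).comp c.symm.toRingHom else θ j with hθ'
    have hA' : ∀ j, IsCMTypeRealisation (Φ' j) (A j) (ι' j) (θ' j) := by
      intro j
      by_cases hj : j = 1
      · subst hj
        simp only [hΦ', hι', hθ', if_true]
        exact (hA 1).transport c
      · simp only [hΦ', hι', hθ', hj, if_false]
        exact hA j
    have hΦ'0 : Φ' 0 = Φ 0 := by simp [hΦ']
    have hΦ'1 : ∀ s, s ∈ (Φ' 1).1 ↔ s ∉ (Φ 1).1 := fun s => by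
      simp only [hΦ', if_true]
      exact mem_cmTypeMap_complexConj_iff (Φ 1) s
    refine hodgeConjectureFor_biproduct_of_card_fibre_eq_one_of_markman hW4 h6 h2 i hK hd hδ hτ hA'
      (Fin.forall_fin_two.2 ⟨?_, ?_⟩) ?_
    · rw [hΦ'0]; exact hone
    · -- one member of `Φ̄₁` over `τ`: the `τ̄`-members of `Φ̄₁` are the conjugates of the two `τ`-members of `Φ₁`
      have hsum := card_fibre_mem_add hττ hdich h6 (Φ' 1)
      have heq : (Finset.univ.filter fun s : K →+* ℂ =>
          s.comp i = ComplexEmbedding.conjugate τ ∧ s ∈ (Φ' 1).1) =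
          (Finset.univ.filter fun s : K →+* ℂ => s.comp i = τ ∧ s ∈ (Φ 1).1).image
            ComplexEmbedding.conjugate := by
        ext s
        simp only [Finset.mem_filter, Finset.mem_univ, true_and, Finset.mem_image, hΦ'1]
        constructor
        · rintro ⟨hs1, hs2⟩
          refine ⟨ComplexEmbedding.conjugate s, ⟨?_, ?_⟩, ComplexEmbedding.involutive_conjugate K s⟩
          · rw [conjugate_comp, hs1, ComplexEmbedding.involutive_conjugate k τ]
          · by_contra h3
            exact hs2 (((Φ 1).2 s).2 h3)
        · rintro ⟨s', ⟨hs1, hs2⟩, rfl⟩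
          exact ⟨by rw [conjugate_comp, hs1], ((Φ 1).2 s').1 hs2⟩
      rw [heq, Finset.card_image_of_injective _ (ComplexEmbedding.involutive_conjugate K).injective, h12] at hsum
      omega
    · rw [hΦ'0]
      intro heq
      apply hne'
      ext s
      rw [Set.mem_compl_iff, heq, hΦ'1, not_not]

/-- **MAIN THEOREM (intrinsic form).  The Hodge conjecture for `A₀ ⊕ A₁` modulo Markman's fourfold theorem**, for two
realisations `A_j ⊨ (K; Φ_j)` of CM types of a sextic CM field `K` that is NOT Galois over `ℚ` and contains an imaginary
quadratic field `k` (via `i`), the types being not induced from `k` (`hprim`: `A_j` simple CM threefolds) and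
inequivalent under `Aut(K) = {1, c}` (`Φ₁ ≠ Φ₀, Φ̄₀`: `A₀ ≁ A₁`) — every rational `(p,p)`-class on the abelian sixfold
`⨁_{j<2} A_j` is algebraic, for every `p`, GIVEN ONLY `Markman2025_weilClasses_algebraic_abelianFourfold`.
[cite: Markman2025SurveySecant, Thm. 1.2 and §11.5 Step 2] [cite: Pohlmann1968, Thm 1] [cite: GaoUllmo2025, Thm 3.1]
[cite: MoonenZarhin1999LowDim, Thm. 0.1] [cite: Shimura1998, §8.4] [cite: Lang2002, VI §1] -/
theorem hodgeConjectureFor_biproduct_of_not_isGalois_of_markman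
    (hW4 : Markman2025_weilClasses_algebraic_abelianFourfold)
    (h6 : Module.finrank ℚ K = 6) (h2 : Module.finrank ℚ k = 2) (i : k →+* K) (hK : ¬ IsGalois ℚ K)
    (hA : ∀ j, IsCMTypeRealisation (Φ j) (A j) (ι j) (θ j))
    (hprim : ∀ j, ∃ s ∈ (Φ j).1, ∃ s' ∈ (Φ j).1, s.comp i ≠ s'.comp i)
    (hne : (Φ 0).1 ≠ (Φ 1).1) (hne' : (Φ 1).1 ≠ (Φ 0).1ᶜ) :
    HodgeConjectureFor (⨁ A).dim (⨁ A).X := by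
  -- `δ ∈ 𝓞_k` with `δ² = -d`, and an embedding `τ₀` with `τ₀(δ) = i√d`
  obtain ⟨δ, d, hd, hδ⟩ := CyclicSextic.exists_sq_eq_neg_nat_of_isTotallyComplex k h2
  obtain ⟨τ₀, hτ₀⟩ := WeilFourfold.exists_apply_eq_I_mul_sqrt hδ
  have hττ : ComplexEmbedding.conjugate τ₀ ≠ τ₀ := CMThreefoldPair.conjugate_ne_of_apply_eq hd hτ₀
  have hdich : ∀ s : K →+* ℂ, s.comp i = τ₀ ∨ s.comp i = ComplexEmbedding.conjugate τ₀ := fun s =>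
    eq_or_eq_conjugate h2 hd hτ₀ (s.comp i)
  rcases card_fibre_mem_eq_one_or_two hττ hdich h6 (hprim 0) with h1 | ⟨-, h1c⟩
  · exact hodgeConjectureFor_biproduct_of_card_fibre_zero_eq_one_of_markman hW4 h6 h2 i hK hd hδ hτ₀ hA h1
      (hprim 1) hne hne'
  · -- use `τ̄₀` and `-δ`: `τ̄₀(-δ) = i√d`
    have hδ' : (((-δ : 𝓞 k) : k)) ^ 2 = -(d : k) := by push_cast; rw [neg_sq]; exact hδ
    have hτ' : ComplexEmbedding.conjugate τ₀ ((-δ : 𝓞 k) : k) = Complex.I * (Real.sqrt d : ℂ) := by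
      push_cast
      rw [map_neg, ComplexEmbedding.conjugate_coe_eq, hτ₀, map_mul, Complex.conj_I, Complex.conj_ofReal]
      ring
    exact hodgeConjectureFor_biproduct_of_card_fibre_zero_eq_one_of_markman hW4 h6 h2 i hK hd hδ' hτ' hA h1c
      (hprim 1) hne hne'

/-- **The Hodge conjecture for `A₀ × A₁`** (the tree's `AbelianVariety.prod`), intrinsic form, modulo Markman.
[cite: Markman2025SurveySecant, Thm. 1.2] [cite: vanGeemen1994HodgeAV, Lemma 3.7] -/
theorem hodgeConjectureFor_prod_of_not_isGalois_of_markman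
    (hW4 : Markman2025_weilClasses_algebraic_abelianFourfold)
    (h6 : Module.finrank ℚ K = 6) (h2 : Module.finrank ℚ k = 2) (i : k →+* K) (hK : ¬ IsGalois ℚ K)
    (hA : ∀ j, IsCMTypeRealisation (Φ j) (A j) (ι j) (θ j))
    (hprim : ∀ j, ∃ s ∈ (Φ j).1, ∃ s' ∈ (Φ j).1, s.comp i ≠ s'.comp i)
    (hne : (Φ 0).1 ≠ (Φ 1).1) (hne' : (Φ 1).1 ≠ (Φ 0).1ᶜ) :
    HodgeConjectureFor ((A 0).prod (A 1)).dim ((A 0).prod (A 1)).X :=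
  PairWeights.hodgeConjectureFor_prod_of_biproduct
    (hodgeConjectureFor_biproduct_of_not_isGalois_of_markman hW4 h6 h2 i hK hA hprim hne hne')

/-- **The Hodge conjecture for every abelian variety dominated by `A₀ ⊕ A₁`** (its isogeny factors; NOT the powers
`A₀^a × A₁^b`), intrinsic form, modulo Markman. [cite: Markman2025SurveySecant, Thm. 1.2] [cite: MumfordAV1970, §19] -/
theorem hodgeConjectureFor_of_avDominatedBy_of_not_isGalois_of_markman
    (hW4 : Markman2025_weilClasses_algebraic_abelianFourfold)
    (h6 : Module.finrank ℚ K = 6) (h2 : Module.finrank ℚ k = 2) (i : k →+* K) (hK : ¬ IsGalois ℚ K)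
    (hA : ∀ j, IsCMTypeRealisation (Φ j) (A j) (ι j) (θ j))
    (hprim : ∀ j, ∃ s ∈ (Φ j).1, ∃ s' ∈ (Φ j).1, s.comp i ≠ s'.comp i)
    (hne : (Φ 0).1 ≠ (Φ 1).1) (hne' : (Φ 1).1 ≠ (Φ 0).1ᶜ)
    {B : AbelianVariety ℂ} (hB : Domination.AVDominatedBy B (⨁ A)) : HodgeConjectureFor B.dim B.X :=
  Domination.hodgeConjectureFor_of_avDominatedBy
    (hodgeConjectureFor_biproduct_of_not_isGalois_of_markman hW4 h6 h2 i hK hA hprim hne hne') hB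

end General

end Summit.HodgeConjecture.CorCM.DihedralSexticPair

end
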